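import Mathlib
import Literature.NumberTheory.Transcendental.KZDominatedFamilyRelations
import Literature.NumberTheory.Transcendental.SemialgebraicMapsProofs
import Summits.KontsevichZagierPeriods.KontsevichZagierPeriods.Theorems.InverseLandauTateLiftingIsotropyPlaneAux

/-!
# `TateLifting` (stmt-KontsevichZagierPeriods-9129), line `Sketch` — stub 59 `AxialEngine`:
# the axial engine with spectators

`tateLifting_axialEngine` is VERBATIM the body of `AxialEngine` (stub 59) of the skeleton
`Cruxes/TateLifting/Lines/Sketch.lean` (its abbreviation `AxInvariant t` unfolded).

**Statement.** Let `t = [τ, f]` be a representation over `ℝ⁷ = (ρ; a₃, b₃, c₃; a₄, b₄, c₄)`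
(indices `0 … 6`) whose domain AND integrand are invariant under the simultaneous rotations of
the coordinate pairs `(1, 2)`, `(4, 5)` (spectators `0, 3, 6`), and let `q` be any representation
over the reduced domain `{w | w 1 > 0, (w 2, w 1, 0, w 3, w 4, w 5, w 6) ∈ τ}` with integrand
`2 w1/(1 + u²) · f (w 2, w 1, 0, w 3, w 4, w 5, w 6)`, `u := w 0`. Then `[t] − [q] ∈ KZ.relations`.

**Proof (inside the rules of the Kontsevich–Zagier calculus)** — the plane engine of
`Theorems/InverseLandauTateLiftingIsotropyPlane.lean` WITH SPECTATORS and an invariant integrand: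
* (1a) excise from `τ` the null set `N = {p | p 2 = 0 ∧ p 1 ≤ 0}` (inside the hyperplane
  `{p 2 = 0}`): `[τ, f] − [τ ∖ N, f] ∈ relations` (`KZ.IntegralRep.of_sub_of_restrict_mem_relations`);
* (2) ONE change of variables (`KZ.changeOfVariablesRel`) from `q` onto `[τ ∖ N, f]` along the
  tan-half-angle chart `Ψ(w) = (w 2, w1 c, w1 s, w 3, c w4 − s w5, s w4 + c w5, w 6)`,
  `c = (1 − u²)/(1 + u²)`, `s = 2u/(1 + u²)`, `w1 = w 1`. Its `7 × 7` Jacobian is block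
  lower-triangular along `Fin 3 ⊕ Fin 4` with diagonal blocks `(0, 0, 1; w1 c′, c, 0; w1 s′, s, 0)`
  (determinant `w1 (c′ s − c s′) = −2 w1/(1 + u²)`) and `1 ⊕ (c, −s, 0; s, c, 0; 0, 0, 1)`
  (determinant `c² + s² = 1`), so `|det Ψ′| = 2 w1/(1 + u²)`; `Ψ` is injective on `{w1 > 0}`,
  maps the reduced domain onto `τ ∖ N` by the invariance of the domain (inverse:
  `w1 = √(p1² + p2²)`, `u = p2/(w1 + p1)`), and `f (Ψ w) = f (w 2, w1, 0, …)` by the invariance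
  of the integrand, whence `q.integrand w = f (Ψ w) · |det Ψ′ w|`.

Design: no definitions (pure proof file); `c, s, c′, s′, Ψ, Ψ′` are section variables constrained
by defining equations, instantiated by `rfl`; the half-angle lemmas are those of
`…IsotropyPlaneAux.lean` (namespace `IsotropyPlane`). References: M. Kontsevich, D. Zagier,
*Periods* (2001), §1.2 rules (1), (2); J. Bochnak, M. Coste, M.-F. Roy, *Real Algebraic Geometry*
(1998), §2.2.
-/

noncomputable section

open MeasureTheory Set
open Literature.NumberTheory.Transcendental
open Literature.ModelTheory.ExponentialFields (IsSemialgebraic isSemialgebraic_setOf_eval_eq_zero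
  isSemialgebraic_setOf_eval_nonneg)

namespace Summit.KontsevichZagierPeriods.InverseLandau

namespace AxialChart

open IsotropyPlane
open MvPolynomial (aeval X)

/-! ### Linear algebra of the block Jacobian -/

/-- `finSumFinEquiv.symm` on `Fin 7 = Fin (3 + 4)`, evaluated. [folklore] -/
theorem finSumFinEquiv_symm_seven (k : Fin 7) : (finSumFinEquiv.symm k : Fin 3 ⊕ Fin 4) =
    (![Sum.inl 0, Sum.inl 1, Sum.inl 2, Sum.inr 0, Sum.inr 1, Sum.inr 2, Sum.inr 3] :
      Fin 7 → Fin 3 ⊕ Fin 4) k := by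
  revert k
  decide

/-- `finSumFinEquiv.symm` on `Fin 4 = Fin (1 + 3)`, evaluated. [folklore] -/
theorem finSumFinEquiv_symm_one_three (k : Fin 4) : (finSumFinEquiv.symm k : Fin 1 ⊕ Fin 3) =
    (![Sum.inl 0, Sum.inr 0, Sum.inr 1, Sum.inr 2] : Fin 4 → Fin 1 ⊕ Fin 3) k := by
  revert k
  decide

/-- Determinant of the block lower-triangular `7 × 7` matrix `(A, 0; C, 1 ⊕ R)` with
`A = (0, 0, 1; a, p, 0; b, q, 0)`, `R = (p, −q, 0; q, p, 0; 0, 0, 1)`: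
`(a q − p b) (p² + q²)`. [folklore] -/
theorem det_blockJac (a b p q k₀ k₁ : ℝ) :
    (Matrix.reindex finSumFinEquiv finSumFinEquiv
        (Matrix.fromBlocks !![0, 0, 1; a, p, 0; b, q, 0] 0 !![0, 0, 0; k₀, 0, 0; k₁, 0, 0; 0, 0, 0]
          (Matrix.reindex finSumFinEquiv finSumFinEquiv
            (Matrix.fromBlocks !![1] 0 0 !![p, -q, 0; q, p, 0; 0, 0, 1]))) :
        Matrix (Fin 7) (Fin 7) ℝ).det = (a * q - p * b) * (p ^ 2 + q ^ 2) := by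
  rw [Matrix.det_reindex_self, Matrix.det_fromBlocks_zero₁₂, Matrix.det_reindex_self,
    Matrix.det_fromBlocks_zero₁₂, Matrix.det_fin_three, Matrix.det_fin_three, Matrix.det_fin_one_of]
  simp only [Matrix.of_apply, Matrix.cons_val]
  ring

/-- The block lower-triangular `7 × 7` matrix `(A, 0; C, 1 ⊕ R)` applied to a vector. [folklore] -/
theorem blockJac_mulVec (a b p q k₀ k₁ : ℝ) (v : Fin 7 → ℝ) :
    (Matrix.reindex finSumFinEquiv finSumFinEquiv
        (Matrix.fromBlocks !![0, 0, 1; a, p, 0; b, q, 0] 0 !![0, 0, 0; k₀, 0, 0; k₁, 0, 0; 0, 0, 0]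
          (Matrix.reindex finSumFinEquiv finSumFinEquiv
            (Matrix.fromBlocks !![1] 0 0 !![p, -q, 0; q, p, 0; 0, 0, 1]))) :
        Matrix (Fin 7) (Fin 7) ℝ).mulVec v =
      ![v 2, a * v 0 + p * v 1, b * v 0 + q * v 1, v 3, k₀ * v 0 + (p * v 4 - q * v 5),
        k₁ * v 0 + (q * v 4 + p * v 5), v 6] := by
  funext i
  fin_cases i <;> simp [Matrix.mulVec, dotProduct, Fin.sum_univ_succ, finSumFinEquiv_symm_seven,
    finSumFinEquiv_symm_one_three]
  ring

section Chart

variable {c s c' s' : ℝ → ℝ}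
  (hc : ∀ u, c u = (1 - u ^ 2) / (1 + u ^ 2)) (hs : ∀ u, s u = 2 * u / (1 + u ^ 2))
  (hc' : ∀ u, c' u = -(4 * u) / (1 + u ^ 2) ^ 2)
  (hs' : ∀ u, s' u = (2 - 2 * u ^ 2) / (1 + u ^ 2) ^ 2)

/-! ### The chart `Ψ(w) = (w 2, w 1 c, w 1 s, w 3, R (w 4, w 5), w 6)` and its Jacobian -/

variable {Ψ : (Fin 7 → ℝ) → Fin 7 → ℝ}
  (hΨ : ∀ w, Ψ w = ![w 2, w 1 * c (w 0), w 1 * s (w 0), w 3, c (w 0) * w 4 - s (w 0) * w 5,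
    s (w 0) * w 4 + c (w 0) * w 5, w 6])
  {Ψ' : (Fin 7 → ℝ) → (Fin 7 → ℝ) →L[ℝ] (Fin 7 → ℝ)}
  (hΨ' : ∀ x, Ψ' x = LinearMap.toContinuousLinearMap (Matrix.toLin'
    (Matrix.reindex finSumFinEquiv finSumFinEquiv
      (Matrix.fromBlocks !![0, 0, 1; x 1 * c' (x 0), c (x 0), 0; x 1 * s' (x 0), s (x 0), 0] 0
        !![0, 0, 0; c' (x 0) * x 4 - s' (x 0) * x 5, 0, 0; s' (x 0) * x 4 + c' (x 0) * x 5, 0, 0;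
          0, 0, 0]
        (Matrix.reindex finSumFinEquiv finSumFinEquiv
          (Matrix.fromBlocks !![1] 0 0
            !![c (x 0), -s (x 0), 0; s (x 0), c (x 0), 0; 0, 0, 1]))) : Matrix (Fin 7) (Fin 7) ℝ)))

include hc hs hΨ in
/-- The chart is a `ℚ`-semialgebraic map on every `ℚ`-semialgebraic set: each coordinate is a
rational function with denominator `1 + u² ≠ 0`. [cite: BCR1998, §2.2] -/
theorem chart_isSemialgebraicMapOn {D : Set (Fin 7 → ℝ)} (hD : IsSemialgebraic ℚ D) :
    IsSemialgebraicMapOn ℚ D Ψ := by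
  have hQ : ∀ x ∈ D, aeval x (1 + X 0 ^ 2 : MvPolynomial (Fin 7) ℚ) ≠ 0 := fun x _ => by
    simp only [map_add, map_one, map_pow, MvPolynomial.aeval_X]
    positivity
  refine IsSemialgebraicMapOn.of_forall hD fun j => ?_
  fin_cases j
  · exact (isSemialgebraicFunOn_aeval hD (X 2)).congr fun x _ => by simp [hΨ]
  · refine (isSemialgebraicFunOn_aeval_div_aeval hD (X 1 * (1 - X 0 ^ 2)) (1 + X 0 ^ 2) hQ).congr
      fun x _ => ?_
    simp only [hΨ, hc, map_mul, map_sub, map_add, map_one, map_pow, MvPolynomial.aeval_X,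
      Matrix.cons_val, Fin.reduceFinMk]
    ring
  · refine (isSemialgebraicFunOn_aeval_div_aeval hD (X 1 * (2 * X 0)) (1 + X 0 ^ 2) hQ).congr
      fun x _ => ?_
    simp only [hΨ, hs, map_mul, map_add, map_one, map_pow, map_ofNat, MvPolynomial.aeval_X,
      Matrix.cons_val, Fin.reduceFinMk]
    ring
  · exact (isSemialgebraicFunOn_aeval hD (X 3)).congr fun x _ => by simp [hΨ]
  · refine (isSemialgebraicFunOn_aeval_div_aeval hD ((1 - X 0 ^ 2) * X 4 - 2 * X 0 * X 5)
      (1 + X 0 ^ 2) hQ).congr fun x _ => ?_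
    simp only [hΨ, hc, hs, map_mul, map_sub, map_add, map_one, map_pow, map_ofNat,
      MvPolynomial.aeval_X, Matrix.cons_val, Fin.reduceFinMk]
    ring
  · refine (isSemialgebraicFunOn_aeval_div_aeval hD (2 * X 0 * X 4 + (1 - X 0 ^ 2) * X 5)
      (1 + X 0 ^ 2) hQ).congr fun x _ => ?_
    simp only [hΨ, hc, hs, map_mul, map_sub, map_add, map_one, map_pow, map_ofNat,
      MvPolynomial.aeval_X, Matrix.cons_val, Fin.reduceFinMk]
    ring
  · exact (isSemialgebraicFunOn_aeval hD (X 6)).congr fun x _ => by simp [hΨ]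

include hc hs hc' hs' hΨ hΨ' in
/-- The chart is differentiable, with derivative the block Jacobian `Ψ′`. [folklore] -/
theorem chart_hasFDerivAt (x : Fin 7 → ℝ) : HasFDerivAt Ψ (Ψ' x) x := by
  have hP : ∀ i : Fin 7, HasFDerivAt (fun w : Fin 7 → ℝ => w i)
      (ContinuousLinearMap.proj (R := ℝ) (φ := fun _ : Fin 7 => ℝ) i) x :=
    fun i => hasFDerivAt_apply i x
  have hcx : HasFDerivAt (fun w : Fin 7 → ℝ => c (w 0))
      (c' (x 0) • ContinuousLinearMap.proj (R := ℝ) (φ := fun _ : Fin 7 => ℝ) 0) x :=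
    (hasDerivAt_halfAngle_c hc hc' (x 0)).comp_hasFDerivAt x (hP 0)
  have hsx : HasFDerivAt (fun w : Fin 7 → ℝ => s (w 0))
      (s' (x 0) • ContinuousLinearMap.proj (R := ℝ) (φ := fun _ : Fin 7 => ℝ) 0) x :=
    (hasDerivAt_halfAngle_s hs hs' (x 0)).comp_hasFDerivAt x (hP 0)
  rw [show Ψ = fun w => ![w 2, w 1 * c (w 0), w 1 * s (w 0), w 3, c (w 0) * w 4 - s (w 0) * w 5,
    s (w 0) * w 4 + c (w 0) * w 5, w 6] from funext hΨ, hΨ', hasFDerivAt_pi']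
  intro i
  fin_cases i
  · refine (hP 2).congr_fderiv (ContinuousLinearMap.ext fun v => ?_)
    simp only [ContinuousLinearMap.coe_comp, Function.comp_apply, ContinuousLinearMap.proj_apply,
      LinearMap.coe_toContinuousLinearMap', Matrix.toLin'_apply, blockJac_mulVec,
      Matrix.cons_val, Fin.reduceFinMk]
  · refine ((hP 1).mul hcx).congr_fderiv (ContinuousLinearMap.ext fun v => ?_)
    simp only [_root_.add_apply, _root_.smul_apply,
      ContinuousLinearMap.coe_comp, Function.comp_apply, ContinuousLinearMap.proj_apply,
      LinearMap.coe_toContinuousLinearMap', Matrix.toLin'_apply, blockJac_mulVec, smul_eq_mul,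
      Matrix.cons_val, Fin.reduceFinMk]
    ring
  · refine ((hP 1).mul hsx).congr_fderiv (ContinuousLinearMap.ext fun v => ?_)
    simp only [_root_.add_apply, _root_.smul_apply,
      ContinuousLinearMap.coe_comp, Function.comp_apply, ContinuousLinearMap.proj_apply,
      LinearMap.coe_toContinuousLinearMap', Matrix.toLin'_apply, blockJac_mulVec, smul_eq_mul,
      Matrix.cons_val, Fin.reduceFinMk]
    ring
  · refine (hP 3).congr_fderiv (ContinuousLinearMap.ext fun v => ?_)
    simp only [ContinuousLinearMap.coe_comp, Function.comp_apply, ContinuousLinearMap.proj_apply,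
      LinearMap.coe_toContinuousLinearMap', Matrix.toLin'_apply, blockJac_mulVec,
      Matrix.cons_val, Fin.reduceFinMk]
  · refine ((hcx.mul (hP 4)).sub (hsx.mul (hP 5))).congr_fderiv
      (ContinuousLinearMap.ext fun v => ?_)
    simp only [_root_.add_apply, _root_.sub_apply,
      _root_.smul_apply, ContinuousLinearMap.coe_comp, Function.comp_apply,
      ContinuousLinearMap.proj_apply, LinearMap.coe_toContinuousLinearMap', Matrix.toLin'_apply,
      blockJac_mulVec, smul_eq_mul, Matrix.cons_val, Fin.reduceFinMk]
    ring
  · refine ((hsx.mul (hP 4)).add (hcx.mul (hP 5))).congr_fderiv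
      (ContinuousLinearMap.ext fun v => ?_)
    simp only [_root_.add_apply, _root_.smul_apply,
      ContinuousLinearMap.coe_comp, Function.comp_apply, ContinuousLinearMap.proj_apply,
      LinearMap.coe_toContinuousLinearMap', Matrix.toLin'_apply, blockJac_mulVec, smul_eq_mul,
      Matrix.cons_val, Fin.reduceFinMk]
    ring
  · refine (hP 6).congr_fderiv (ContinuousLinearMap.ext fun v => ?_)
    simp only [ContinuousLinearMap.coe_comp, Function.comp_apply, ContinuousLinearMap.proj_apply,
      LinearMap.coe_toContinuousLinearMap', Matrix.toLin'_apply, blockJac_mulVec,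
      Matrix.cons_val, Fin.reduceFinMk]

include hc hs hc' hs' hΨ' in
/-- The Jacobian determinant of the chart: `det Ψ′ = −2 w1/(1 + u²)` (`w1 = x 1`, `u = x 0`).
[folklore] -/
theorem chart_det (x : Fin 7 → ℝ) : (Ψ' x).det = -(2 * x 1 / (1 + x 0 ^ 2)) := by
  rw [hΨ']
  change LinearMap.det (Matrix.toLin' (_ : Matrix (Fin 7) (Fin 7) ℝ)) = _
  rw [LinearMap.det_toLin', det_blockJac, halfAngle_sq_add_sq hc hs (x 0),
    det_polarBlock hc hs hc' hs']
  ring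

include hc hs hΨ in
/-- The chart is injective on the reduced domain `{w 1 > 0, (w 2, w 1, 0, w 3, …, w 6) ∈ τ}` (indeed
on `{w 1 > 0}`). [folklore] -/
theorem chart_injOn (τ : Set (Fin 7 → ℝ)) :
    InjOn Ψ {w : Fin 7 → ℝ | 0 < w 1 ∧ (![w 2, w 1, 0, w 3, w 4, w 5, w 6] : Fin 7 → ℝ) ∈ τ} := by
  intro w hw w' hw' h
  have hw1 : 0 < w 1 := hw.1
  have hw1' : 0 < w' 1 := hw'.1
  rw [hΨ, hΨ] at h
  simp only [Matrix.vecCons_inj, and_true] at h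
  obtain ⟨e0, e1, e2, e3, e4, e5, e6⟩ := h
  have hA := halfAngle_sq_add_sq hc hs (w 0)
  have hB := halfAngle_sq_add_sq hc hs (w' 0)
  have h11 : w 1 ^ 2 = w' 1 ^ 2 := by
    linear_combination (w 1 * c (w 0) + w' 1 * c (w' 0)) * e1 +
      (w 1 * s (w 0) + w' 1 * s (w' 0)) * e2 - (w 1) ^ 2 * hA + (w' 1) ^ 2 * hB
  have h1 : w 1 = w' 1 := (pow_left_inj₀ hw1.le hw1'.le two_ne_zero).1 h11
  rw [← h1] at e1 e2
  have hcc : c (w 0) = c (w' 0) := mul_left_cancel₀ hw1.ne' e1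
  have hss : s (w 0) = s (w' 0) := mul_left_cancel₀ hw1.ne' e2
  have h0 : w 0 = w' 0 := halfAngle_inj hc hs hcc hss
  rw [← h0] at e4 e5
  have h4 : w 4 = w' 4 := by
    linear_combination c (w 0) * e4 + s (w 0) * e5 - (w 4 - w' 4) * hA
  have h5 : w 5 = w' 5 := by
    linear_combination (-s (w 0)) * e4 + c (w 0) * e5 - (w 5 - w' 5) * hA
  funext i
  fin_cases i <;> assumption

include hc hs hΨ in
/-- The chart maps the reduced domain `{w 1 > 0, (w 2, w 1, 0, w 3, w 4, w 5, w 6) ∈ τ}` ONTO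
`τ ∖ N`, `N = {p 2 = 0, p 1 ≤ 0}`, for every `τ` invariant under the simultaneous rotations of the
pairs `(1, 2)`, `(4, 5)` (rotate by the angle of `u` one way, by its opposite the other way).
[folklore] -/
theorem chart_image (τ : Set (Fin 7 → ℝ))
    (hO : ∀ p ∈ τ, ∀ a b : ℝ, a ^ 2 + b ^ 2 = 1 →
      (![p 0, a * p 1 - b * p 2, b * p 1 + a * p 2, p 3, a * p 4 - b * p 5, b * p 4 + a * p 5,
        p 6] : Fin 7 → ℝ) ∈ τ) :
    Ψ '' {w | 0 < w 1 ∧ (![w 2, w 1, 0, w 3, w 4, w 5, w 6] : Fin 7 → ℝ) ∈ τ} =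
      τ \ {x | x 2 = 0 ∧ x 1 ≤ 0} := by
  apply Subset.antisymm
  · rintro _ ⟨w, ⟨hw1, hwτ⟩, rfl⟩
    have hw1 : 0 < w 1 := hw1
    have hcs := halfAngle_sq_add_sq hc hs (w 0)
    refine ⟨?_, ?_⟩
    · have h := hO _ hwτ (c (w 0)) (s (w 0)) hcs
      simp only [Matrix.cons_val] at h
      convert h using 1
      rw [hΨ]
      funext i
      fin_cases i <;> simp <;> ring
    · rintro ⟨h2, h1⟩
      rw [hΨ] at h2 h1
      simp only [Matrix.cons_val] at h2 h1
      have hs0 : s (w 0) = 0 := (mul_eq_zero.1 h2).resolve_left hw1.ne'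
      have hu : w 0 = 0 := halfAngle_s_eq_zero hs hs0
      rw [hu, halfAngle_c_zero hc] at h1
      linarith
  · rintro x ⟨hxτ, hxN⟩
    obtain ⟨u, ρ, hρ, hx1, hx2⟩ := polar_exists hc hs (x 1) (x 2) hxN
    have hcs := halfAngle_sq_add_sq hc hs u
    have hcs' : c u ^ 2 + (-s u) ^ 2 = 1 := by rw [neg_sq]; exact hcs
    have h := hO x hxτ (c u) (-s u) hcs'
    have k1 : c u * x 1 - -s u * x 2 = ρ := by rw [hx1, hx2]; linear_combination ρ * hcs
    have k2 : -s u * x 1 + c u * x 2 = 0 := by rw [hx1, hx2]; ring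
    rw [k1, k2] at h
    refine ⟨![u, ρ, x 0, x 3, c u * x 4 - -s u * x 5, -s u * x 4 + c u * x 5, x 6], ⟨?_, ?_⟩, ?_⟩
    · show 0 < ρ
      exact hρ
    · simpa using h
    · rw [hΨ]
      funext i
      fin_cases i
      · simp
      · simp only [Matrix.cons_val, Fin.reduceFinMk]
        exact hx1.symm
      · simp only [Matrix.cons_val, Fin.reduceFinMk]
        exact hx2.symm
      · simp
      · simp only [Matrix.cons_val, Fin.reduceFinMk]
        linear_combination x 4 * hcs
      · simp only [Matrix.cons_val, Fin.reduceFinMk]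
        linear_combination x 5 * hcs
      · simp

end Chart

end AxialChart

open AxialChart IsotropyPlane in
/-- **The axial engine with spectators** (stub 59 `AxialEngine` of the line `Sketch` for
`TateLifting`, stmt-KontsevichZagierPeriods-9129). For a representation `t = [τ, f]` over `ℝ⁷`
whose domain and integrand are invariant under the simultaneous rotations of the coordinate pairs
`(1, 2)`, `(4, 5)`, and every representation `q` over the reduced domain
`{w | w 1 > 0, (w 2, w 1, 0, w 3, w 4, w 5, w 6) ∈ τ}` with integrand
`2 w1/(1 + u²) · f (w 2, w 1, 0, w 3, w 4, w 5, w 6)`: `[t] − [q] ∈ KZ.relations` — excise the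
null set `{p 2 = 0, p 1 ≤ 0}` (rule (1a)), then ONE change of variables (rule (2)) along the
tan-half-angle chart, Jacobian `|det Ψ′| = 2 w1/(1 + u²)`, the integrand being matched by the
invariance of `f`. [cite: KontsevichZagier2001, §1.2 rule (2)] -/
theorem tateLifting_axialEngine :
  ∀ (t : KZ.IntegralRep 7), (∀ p ∈ t.domain, ∀ c s : ℝ, c ^ 2 + s ^ 2 = 1 →
    (![p 0, c * p 1 - s * p 2, s * p 1 + c * p 2, p 3, c * p 4 - s * p 5, s * p 4 + c * p 5, p 6] : Fin 7 → ℝ) ∈ t.domain ∧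
    t.integrand (![p 0, c * p 1 - s * p 2, s * p 1 + c * p 2, p 3, c * p 4 - s * p 5, s * p 4 + c * p 5, p 6] : Fin 7 → ℝ) =
      t.integrand p) →
    ∀ (q : KZ.IntegralRep 7),
      q.domain = {w | 0 < w 1 ∧ (![w 2, w 1, 0, w 3, w 4, w 5, w 6] : Fin 7 → ℝ) ∈ t.domain} →
      (∀ w ∈ q.domain, q.integrand w =
        2 / (1 + w 0 ^ 2) * w 1 * t.integrand (![w 2, w 1, 0, w 3, w 4, w 5, w 6] : Fin 7 → ℝ)) →
      KZ.of t - KZ.of q ∈ KZ.relations := by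
  intro t hinv q hq hq1
  -- the half-angle functions, the chart and its Jacobian, abstracted behind defining equations
  obtain ⟨c, hc⟩ : ∃ c : ℝ → ℝ, ∀ u, c u = (1 - u ^ 2) / (1 + u ^ 2) := ⟨_, fun _ => rfl⟩
  obtain ⟨s, hs⟩ : ∃ s : ℝ → ℝ, ∀ u, s u = 2 * u / (1 + u ^ 2) := ⟨_, fun _ => rfl⟩
  obtain ⟨c', hc'⟩ : ∃ c' : ℝ → ℝ, ∀ u, c' u = -(4 * u) / (1 + u ^ 2) ^ 2 := ⟨_, fun _ => rfl⟩
  obtain ⟨s', hs'⟩ : ∃ s' : ℝ → ℝ, ∀ u, s' u = (2 - 2 * u ^ 2) / (1 + u ^ 2) ^ 2 :=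
    ⟨_, fun _ => rfl⟩
  obtain ⟨Ψ, hΨ⟩ : ∃ Ψ : (Fin 7 → ℝ) → Fin 7 → ℝ, ∀ w, Ψ w = ![w 2, w 1 * c (w 0),
      w 1 * s (w 0), w 3, c (w 0) * w 4 - s (w 0) * w 5, s (w 0) * w 4 + c (w 0) * w 5, w 6] :=
    ⟨_, fun _ => rfl⟩
  obtain ⟨Ψ', hΨ'⟩ : ∃ Ψ' : (Fin 7 → ℝ) → (Fin 7 → ℝ) →L[ℝ] (Fin 7 → ℝ), ∀ x, Ψ' x =
      LinearMap.toContinuousLinearMap (Matrix.toLin'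
        (Matrix.reindex finSumFinEquiv finSumFinEquiv
          (Matrix.fromBlocks !![0, 0, 1; x 1 * c' (x 0), c (x 0), 0; x 1 * s' (x 0), s (x 0), 0] 0
            !![0, 0, 0; c' (x 0) * x 4 - s' (x 0) * x 5, 0, 0; s' (x 0) * x 4 + c' (x 0) * x 5, 0, 0;
              0, 0, 0]
            (Matrix.reindex finSumFinEquiv finSumFinEquiv
              (Matrix.fromBlocks !![1] 0 0
                !![c (x 0), -s (x 0), 0; s (x 0), c (x 0), 0; 0, 0, 1]))) :
          Matrix (Fin 7) (Fin 7) ℝ)) :=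
    ⟨_, fun _ => rfl⟩
  -- (1a) excise the null set `N = {p 2 = 0, p 1 ≤ 0}`
  have hN : IsSemialgebraic ℚ {x : Fin 7 → ℝ | x 2 = 0 ∧ x 1 ≤ 0} := by
    have h1 := isSemialgebraic_setOf_eval_eq_zero (k := ℚ) (R := ℝ)
      (MvPolynomial.X 2 : MvPolynomial (Fin 7) ℚ)
    have h2 := isSemialgebraic_setOf_eval_nonneg (k := ℚ) (R := ℝ)
      (-MvPolynomial.X 1 : MvPolynomial (Fin 7) ℚ)
    convert h1.inter h2 using 1
    ext x
    simp
  have hE : IsSemialgebraic ℚ (t.domain \ {x | x 2 = 0 ∧ x 1 ≤ 0}) :=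
    t.isSemialgebraic_domain.diff hN
  have hEr : t.domain \ {x | x 2 = 0 ∧ x 1 ≤ 0} ⊆ t.domain := fun x hx => hx.1
  have hvol : volume (t.domain \ (t.domain \ {x : Fin 7 → ℝ | x 2 = 0 ∧ x 1 ≤ 0})) = 0 := by
    refine measure_mono_null (fun x hx => ?_)
      (show volume {x : Fin 7 → ℝ | x 2 = 0} = 0 by rw [volume_pi]; exact Measure.pi_hyperplane _ 2 0)
    exact (not_not.1 fun h => hx.2 ⟨hx.1, h⟩ : x ∈ {x : Fin 7 → ℝ | x 2 = 0 ∧ x 1 ≤ 0}).1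
  have h1 : KZ.of t - KZ.of (t.restrict _ hE hEr) ∈ KZ.relations :=
    KZ.IntegralRep.of_sub_of_restrict_mem_relations t hE hEr hvol
  -- (2) one change of variables from `q` onto `[τ ∖ N, f]`
  have himage : Ψ '' q.domain = t.domain \ {x | x 2 = 0 ∧ x 1 ≤ 0} := by
    rw [hq]
    exact chart_image hc hs hΨ t.domain fun p hp a b hab => (hinv p hp a b hab).1
  have h2 : KZ.of q - KZ.of (t.restrict _ hE hEr) ∈ KZ.relations := by
    refine KZ.changeOfVariablesRel_subset_relations ⟨7, q, t.restrict _ hE hEr, Ψ, Ψ',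
      chart_isSemialgebraicMapOn hc hs hΨ q.isSemialgebraic_domain,
      fun x _ => (chart_hasFDerivAt hc hs hc' hs' hΨ hΨ' x).hasFDerivWithinAt,
      hq ▸ chart_injOn hc hs hΨ t.domain, himage.symm, fun x hx => ?_, rfl⟩
    have hx' : 0 < x 1 ∧ (![x 2, x 1, 0, x 3, x 4, x 5, x 6] : Fin 7 → ℝ) ∈ t.domain := by
      rw [hq] at hx
      exact hx
    have hx1 : 0 < x 1 := hx'.1
    have key : t.integrand (Ψ x) = t.integrand (![x 2, x 1, 0, x 3, x 4, x 5, x 6] : Fin 7 → ℝ) := by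
      rw [← (hinv _ hx'.2 (c (x 0)) (s (x 0)) (halfAngle_sq_add_sq hc hs (x 0))).2]
      congr 1
      rw [hΨ]
      funext i
      fin_cases i <;> simp <;> ring
    rw [hq1 x hx, KZ.IntegralRep.integrand_restrict, key,
      chart_det hc hs hc' hs' hΨ' x, abs_neg, abs_of_pos (by positivity)]
    ring
  have e : KZ.of t - KZ.of q =
      (KZ.of t - KZ.of (t.restrict _ hE hEr)) - (KZ.of q - KZ.of (t.restrict _ hE hEr)) := by
    abel
  rw [e]
  exact KZ.relations.sub_mem h1 h2

end Summit.KontsevichZagierPeriods.InverseLandau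

end
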